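import Summits.HodgeConjecture.HodgeConjecture.Theorems.Ring2HypothesesDescentAbsoluteCorrespondenceLift
import Summits.HodgeConjecture.HodgeConjecture.Theorems.Ring2HypothesesDescentCurvePowersSections
import Summits.HodgeConjecture.HodgeConjecture.Theorems.Ring2HypothesesDescentAbsoluteHalvingWords
import HarnessLib

/-!
# Ring 2 — hypotheses layer, descent axis: ROW b06 GOVERNS ARAPURA'S STRICT ABELIAN CLASS, DESCENDS ALONG ARBITRARY
# SURJECTIONS, AND IS «ABSOLUTE HODGE ⟹ ALGEBRAIC ON THE CARTESIAN POWERS OF CURVES» — WITHOUT DELIGNE'S MAIN THEOREM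

HONEST FRAMING (page 1, verbatim the cell's standing line): **research route conditional on HC_CM; not a
corollary; Q11.4-sentence-2 already refuted in dim ≥ 3.** Nothing in this file proves a case of the Hodge conjecture;
nothing discharges the binder of record b06 `Ring2.Hypotheses.AbsoluteHodgeImpliesAlgebraicAV` («absolute Hodge classes
on complex abelian varieties are algebraic», `Ring2HypothesesDescent.lean` :73; OPEN); the binder table's numbers do not
move. `HC_CM` (`Theses.RankFourFaces.CMAbelianHodge`) and `HC_AV` do not occur in this file; row b06 occurs only as the
displayed hypothesis `h` or inside `↔` / under `¬`, and is NOT asserted.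

Hodge ladder STAGE 3, `BINDER-OWNERS.md` row **b06**, seat `ring2-b06` (gen 76). Gen 75 read `HC_AV` on the cartesian
powers of curves HYPOTHESIS-FREE (Arapura 2006 Lemma 1.3 + Lemma 4.2 + Lange–Birkenhake 4.5.8, `hc_av_iff_curvePow`) but
could read ROW b06 there only modulo Deligne's Main Theorem 2.11 (fact c1), because the tree's descent of «absolute Hodge
⟹ algebraic» was equidimensional (`f_* f^* = deg f`, gen 73) while Serre's / Lange–Birkenhake's surjections are not.
The companions of this gen supply the missing AH-version of Arapura's Lemma 4.2 (`absoluteHodge_algebraic_of_isDominatedByPowers`,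
from Deligne–Milne II Prop. 6.5 on the real carriers), modulo the SIX class-level facts of Deligne's §2 already OF RECORD
in the tree — (N) `chartConjugation_canonical`, (E) existence of conjugates, (V-B3) `deligne1982_cycleClass_absoluteHodge`,
(T1c) `deligne1982_lefschetz_absoluteHodge_iff`, (CS7) `deligne1982_cupProduct_absoluteHodge`, (CS8)
`deligne1982_gysinFst_absoluteHodge` — displayed as hypotheses `hN hex hZ hL hcup hgys` of every theorem below (c1 is
NOT among them; nothing new, nothing discharged). This file reads row b06 through it:

* §1 row b06 gives «AH ⟹ algebraic» on every cartesian power `A.X^e` (mod (N)+(E): transport along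
  `CorCM.Stage4.powSuccXIso : (A^{k+1}).X ≅ A.X^{k+1}`).
* §2 **ROW b06 ⟹ «AH ⟹ algebraic» ON EVERY SMOOTH PROJECTIVE VARIETY DOMINATED BY THE POWERS OF AN ABELIAN VARIETY**
  (Arapura's strict abelian class: products of curves and abelian varieties, their powers, smooth surjective images…)
  and **ROW b06 ⟺ Charles–Schnell's 11.2.18 on that whole class** (`⟸`: `isDominatedByPowers_self`).
* §3 **«AH ⟹ algebraic» DESCENDS ALONG EVERY SURJECTIVE MORPHISM `Z ↠ Y` OF SMOOTH PROJECTIVE VARIETIES OF ANY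
  DIMENSIONS, granted it holds on the powers of `Z`** (`isDominatedByPowers_of_surjective`) — gen 73's equidimensional
  gap closed (the price of arbitrary relative dimension is the powers of the source, as in Arapura's lemma).
* §4 **`absoluteHodgeImpliesAlgebraicAV_iff_curvePow_of_facts` — ROW b06 ⟺ ON EVERY CARTESIAN POWER `Cᵏ` OF EVERY
  SMOOTH PROJECTIVE COMPLEX CURVE EVERY ABSOLUTE HODGE CLASS IS ALGEBRAIC** — mod the six facts, WITHOUT c1; `¬`-form (a
  counterexample to row b06, if any, can be moved to a power of a curve by absolute-Hodge means alone); per abelian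
  variety ONE curve decides; per curve the powers of `J(C)` decide the powers of `C`; the `AbsoluteHodgeClassesAreAlgebraicFor`
  wording; and the Jacobian-free form through `H¹`-capturing curve sections (gen 75's domination
  `isDominatedByPowers_of_injective_complexBetti_map_one`).

HONEST COLUMN. Nothing is discharged; «10 · 0» unchanged; row b06 is never asserted; the six facts are OF RECORD and
occur only as hypotheses; no definition, no new named fact, no sorry. NOT obtained: the same modulo (N)+(E) ONLY (the
lift needs T1c + CS7 + CS8 + V-B3 — the semisimplicity inputs), a genus or exponent bound, a middle-degree curve-power
form of row b06 (padding leaves the class of curve powers), the discharge of any of the six facts (lane lit-hodgefound's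
programme rows V-B2′/V-B2″/V-B3/T1/T7).

PRESEARCH: [corpus: `paper:arxiv-math_0501348` Arapura 2006 §1 Lemma 1.1/1.3, §4 Lemma 4.2]; [corpus: Deligne–Milne 1982
II Prop. 6.5]; [corpus: book:cattani2014-…-49 Charles–Schnell §11.2.5 11.2.17–11.2.18 and Voisin's reduction Thm.
11.2.19]; corpus hybrid/vector + galaxy all stars «absolute Hodge classes algebraic curves|powers of curves absolute
Hodge»: no printed statement of §4 — certification by assembly, no novelty in print claimed.

References (bib keys): Arapura2006 (§1 Lemma 1.1, 1.3, §4 Lemma 4.2), DeligneMilne1982Tannakian (II Prop. 6.5),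
Deligne1982HodgeCycles (§2 Ex. 2.1, Main Thm. 2.11), CharlesSchnell2014Notes (Def. 11.2.3, Prop. 11.2.8, 11.2.17–11.2.19),
LangeBirkenhake1992 (Prop. 4.5.8), Milne1986JacobianVarieties (§10 Thm. 10.1), MumfordAV1970 (§19).
-/

noncomputable section

set_option linter.dupNamespace false

open CategoryTheory AlgebraicGeometry MonoidalCategory CartesianMonoidalCategory
open Literature.AlgebraicGeometry Literature.AlgebraicGeometry.Motives
open Literature.AlgebraicGeometry.HodgeTheory
open Summit.HodgeConjecture.HodgeConjecture.Theorems
open Summit.HodgeConjecture.CorCM.Stage4 (powSuccXIso dim_powSucc' isDominatedByPowers_self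
  isDominatedByPowers_pow_succ isDominatedByPowers_curve_jacobian isDominatedByPowers_of_surjective)

namespace Summit.HodgeConjecture.HodgeConjecture.Ring2.Hypotheses

/-! ## §1 Row b06 on the cartesian powers of an abelian variety (mod (N)+(E)) -/

/-- **Row b06 gives «absolute Hodge ⟹ algebraic» on every cartesian power `A.X^e`** (dimension `e · dim A`): `A.X⁰ =
Spec ℂ` carries only algebraic classes in even degrees (`algebraic_pow_zero`), and `A.X^{k+1} ≅ (A^{k+1}).X` is the
variety of the abelian variety `A.powSucc k` (`CorCM.Stage4.powSuccXIso`, `dim_powSucc'`), along which absolute Hodge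
classes pull back (mod (N)+(E), `absolutePullback_of_canonical`) and algebraic classes transport
(`mem_algebraicClasses_map_iff_of_iso`). Row b06 is the displayed hypothesis `h`, NOT asserted.
[cite: CharlesSchnell2014Notes, §11.2.2 (11.2.2) and 11.2.18] [cite: MumfordAV1970, §19] -/
theorem absoluteHodge_algebraic_pow_of_absoluteHodgeImpliesAlgebraicAV (hN : chartConjugation_canonical)
    (hex : ∀ ⦃n : ℕ⦄ ⦃X : SchemeOver ℂ⦄, IsSmoothProjective n X →
      ∀ (σ : ℂ ≃+* ℂ) (p : ℕ) (c : complexBetti X (2 * p)), ∃ s, IsConjugateClass σ X (2 * p) c s)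
    (h : AbsoluteHodgeImpliesAlgebraicAV) (A : AbelianVariety ℂ) :
    ∀ (e p : ℕ) (y : complexBetti (A.X.pow e) (2 * p)),
      IsAbsoluteHodgeClass (e * A.dim) (A.X.pow e) p y → y ∈ algebraicClasses (A.X.pow e) p
  | 0, p, y, _ => algebraic_pow_zero (AbelianVariety.isSmoothProjective_holds (A := A)) p y
  | k + 1, p, y, hy => by
    have hB : IsSmoothProjective ((k + 1) * A.dim) (A.powSucc k).X := by
      have h' : IsSmoothProjective (A.powSucc k).dim (A.powSucc k).X := AbelianVariety.isSmoothProjective_holds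
      rwa [dim_powSucc'] at h'
    have hP : IsSmoothProjective ((k + 1) * A.dim) (A.X.pow (k + 1)) :=
      (AbelianVariety.isSmoothProjective_holds (A := A)).pow (k + 1)
    have hy' : IsAbsoluteHodgeClass ((k + 1) * A.dim) (A.powSucc k).X p
        (complexBetti.map (powSuccXIso A k).hom (2 * p) y) :=
      absolutePullback_of_canonical hN hex hB hP (powSuccXIso A k).hom p y hy
    have halg : complexBetti.map (powSuccXIso A k).hom (2 * p) y ∈ algebraicClasses (A.powSucc k).X p := by
      have hk := h (A.powSucc k) p
      rw [dim_powSucc'] at hk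
      exact hk _ hy'
    exact (mem_algebraicClasses_map_iff_of_iso (powSuccXIso A k)).1 halg

/-! ## §2 Arapura's strict abelian class: row b06 is Charles–Schnell's 11.2.18 restricted to it (mod the six facts) -/

section Dominated

variable {m : ℕ} {V : SchemeOver ℂ}

/-- **ROW b06 ⟹ «ABSOLUTE HODGE ⟹ ALGEBRAIC» ON EVERY SMOOTH PROJECTIVE VARIETY DOMINATED BY THE POWERS OF A COMPLEX
ABELIAN VARIETY** (`HodgeTheory.IsDominatedByPowers m V A.dim A.X`), mod the six facts: the companion's AH-version of
Arapura's Lemma 4.2 (`absoluteHodge_algebraic_of_isDominatedByPowers`) fed with §1. Row b06 is the displayed hypothesis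
`h`, NOT asserted. [cite: Arapura2006, §4 Lemma 4.2 and §1 Lemma 1.1] [cite: DeligneMilne1982Tannakian, II Prop. 6.5] -/
theorem absoluteHodge_algebraic_of_isDominatedByPowers_abelianVariety (hN : chartConjugation_canonical)
    (hex : ∀ ⦃n : ℕ⦄ ⦃X : SchemeOver ℂ⦄, IsSmoothProjective n X →
      ∀ (σ : ℂ ≃+* ℂ) (p : ℕ) (c : complexBetti X (2 * p)), ∃ s, IsConjugateClass σ X (2 * p) c s)
    (hZ : deligne1982_cycleClass_absoluteHodge) (hL : deligne1982_lefschetz_absoluteHodge_iff)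
    (hcup : deligne1982_cupProduct_absoluteHodge) (hgys : deligne1982_gysinFst_absoluteHodge)
    (h : AbsoluteHodgeImpliesAlgebraicAV) (hV : IsSmoothProjective m V) (A : AbelianVariety ℂ)
    (hdom : IsDominatedByPowers m V A.dim A.X) (p : ℕ) (c : complexBetti V (2 * p))
    (hc : IsAbsoluteHodgeClass m V p c) : c ∈ algebraicClasses V p :=
  absoluteHodge_algebraic_of_isDominatedByPowers hN hex hZ hL hcup hgys hV AbelianVariety.isSmoothProjective_holds hdom
    (absoluteHodge_algebraic_pow_of_absoluteHodgeImpliesAlgebraicAV hN hex h A) p c hc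

/-- **… in the words of Charles–Schnell's 11.2.18 at a variety: row b06 ⟹ `AbsoluteHodgeClassesAreAlgebraicFor m V` for
every `V` dominated by the powers of an abelian variety** (the Hodge-model conjunct is the tree's
`nonempty_hodgeModel_holds`), mod the six facts. Row b06 is the displayed hypothesis `h`, NOT asserted.
[cite: CharlesSchnell2014Notes, §11.2.5 statement 11.2.18] [cite: Arapura2006, §4 Lemma 4.2] -/
theorem absoluteHodgeClassesAreAlgebraicFor_of_isDominatedByPowers_abelianVariety (hN : chartConjugation_canonical)
    (hex : ∀ ⦃n : ℕ⦄ ⦃X : SchemeOver ℂ⦄, IsSmoothProjective n X →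
      ∀ (σ : ℂ ≃+* ℂ) (p : ℕ) (c : complexBetti X (2 * p)), ∃ s, IsConjugateClass σ X (2 * p) c s)
    (hZ : deligne1982_cycleClass_absoluteHodge) (hL : deligne1982_lefschetz_absoluteHodge_iff)
    (hcup : deligne1982_cupProduct_absoluteHodge) (hgys : deligne1982_gysinFst_absoluteHodge)
    (h : AbsoluteHodgeImpliesAlgebraicAV) (hV : IsSmoothProjective m V) (A : AbelianVariety ℂ)
    (hdom : IsDominatedByPowers m V A.dim A.X) : AbsoluteHodgeClassesAreAlgebraicFor m V :=
  ⟨nonempty_hodgeModel_holds hV, fun p c hc ↦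
    absoluteHodge_algebraic_of_isDominatedByPowers_abelianVariety hN hex hZ hL hcup hgys h hV A hdom p c hc⟩

/-- **… and on all positive cartesian powers `V^{k+1}`** (dominated by the powers of the same `A`,
`CorCM.Stage4.isDominatedByPowers_pow_succ`), mod the six facts. Row b06 is the displayed hypothesis `h`, NOT asserted.
[cite: Arapura2006, §4 Lemma 4.2 and §1 Lemma 1.1] -/
theorem absoluteHodgeClassesAreAlgebraicFor_pow_of_isDominatedByPowers_abelianVariety (hN : chartConjugation_canonical)
    (hex : ∀ ⦃n : ℕ⦄ ⦃X : SchemeOver ℂ⦄, IsSmoothProjective n X →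
      ∀ (σ : ℂ ≃+* ℂ) (p : ℕ) (c : complexBetti X (2 * p)), ∃ s, IsConjugateClass σ X (2 * p) c s)
    (hZ : deligne1982_cycleClass_absoluteHodge) (hL : deligne1982_lefschetz_absoluteHodge_iff)
    (hcup : deligne1982_cupProduct_absoluteHodge) (hgys : deligne1982_gysinFst_absoluteHodge)
    (h : AbsoluteHodgeImpliesAlgebraicAV) (hV : IsSmoothProjective m V) (A : AbelianVariety ℂ)
    (hdom : IsDominatedByPowers m V A.dim A.X) (k : ℕ) : AbsoluteHodgeClassesAreAlgebraicFor ((k + 1) * m) (V.pow (k + 1)) :=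
  absoluteHodgeClassesAreAlgebraicFor_of_isDominatedByPowers_abelianVariety hN hex hZ hL hcup hgys h (hV.pow (k + 1)) A
    (isDominatedByPowers_pow_succ AbelianVariety.isSmoothProjective_holds hV hdom k)

/-- **ROW b06 ⟺ CHARLES–SCHNELL'S 11.2.18 ON ARAPURA'S WHOLE STRICT ABELIAN CLASS** (every smooth projective complex
variety dominated by the powers of some abelian variety), mod the six facts (`⟸`: an abelian variety is dominated by its
own powers, `CorCM.Stage4.isDominatedByPowers_self`). Neither side is asserted. [cite: Arapura2006, §4 Lemma 4.2 and §1 Lemma 1.1]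
[cite: CharlesSchnell2014Notes, §11.2.5 statement 11.2.18] [cite: DeligneMilne1982Tannakian, II Prop. 6.5] -/
theorem absoluteHodgeImpliesAlgebraicAV_iff_forall_isDominatedByPowers_abelianVariety (hN : chartConjugation_canonical)
    (hex : ∀ ⦃n : ℕ⦄ ⦃X : SchemeOver ℂ⦄, IsSmoothProjective n X →
      ∀ (σ : ℂ ≃+* ℂ) (p : ℕ) (c : complexBetti X (2 * p)), ∃ s, IsConjugateClass σ X (2 * p) c s)
    (hZ : deligne1982_cycleClass_absoluteHodge) (hL : deligne1982_lefschetz_absoluteHodge_iff)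
    (hcup : deligne1982_cupProduct_absoluteHodge) (hgys : deligne1982_gysinFst_absoluteHodge) :
    AbsoluteHodgeImpliesAlgebraicAV ↔
      ∀ ⦃m : ℕ⦄ ⦃V : SchemeOver ℂ⦄ (A : AbelianVariety ℂ), IsSmoothProjective m V →
        IsDominatedByPowers m V A.dim A.X → AbsoluteHodgeClassesAreAlgebraicFor m V :=
  ⟨fun h _ _ A hV hdom ↦
      absoluteHodgeClassesAreAlgebraicFor_of_isDominatedByPowers_abelianVariety hN hex hZ hL hcup hgys h hV A hdom,
    fun h A p c hc ↦ (h A AbelianVariety.isSmoothProjective_holds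
      (isDominatedByPowers_self AbelianVariety.isSmoothProjective_holds)).2 p c hc⟩

end Dominated

/-! ## §3 «Absolute Hodge ⟹ algebraic» descends along ARBITRARY surjections, granted the powers of the source -/

section Surjections

variable {dZ dY : ℕ} {Z Y : SchemeOver ℂ}

/-- **«ABSOLUTE HODGE ⟹ ALGEBRAIC» DESCENDS ALONG EVERY SURJECTIVE MORPHISM `f : Z ↠ Y` OF SMOOTH PROJECTIVE COMPLEX
VARIETIES OF ANY DIMENSIONS, granted it holds on all cartesian powers of `Z`** (mod the six facts): `Y` is dominated by
the powers of `Z` (`CorCM.Stage4.isDominatedByPowers_of_surjective` with `isDominatedByPowers_self`: `f^*` is injective,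
`f_* (f^* y ∪ h^r)`-type correspondences span) and the companion's Lemma 4.2 applies. Gen 73's
`absoluteHodge_algebraic_of_surjective_of_canonical` is the EQUIDIMENSIONAL case, which needs `Z` alone and (N)+(E) alone.
The hypothesis on the powers of `Z` is NOT asserted. [cite: Arapura2006, §1 Cor. 1.2 and §4 Lemma 4.2]
[cite: CharlesSchnell2014Notes, §11.2.5 statement 11.2.18] -/
theorem absoluteHodge_algebraic_of_surjective_of_powers (hN : chartConjugation_canonical)
    (hex : ∀ ⦃n : ℕ⦄ ⦃X : SchemeOver ℂ⦄, IsSmoothProjective n X →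
      ∀ (σ : ℂ ≃+* ℂ) (p : ℕ) (c : complexBetti X (2 * p)), ∃ s, IsConjugateClass σ X (2 * p) c s)
    (hZ : deligne1982_cycleClass_absoluteHodge) (hL : deligne1982_lefschetz_absoluteHodge_iff)
    (hcup : deligne1982_cupProduct_absoluteHodge) (hgys : deligne1982_gysinFst_absoluteHodge)
    (hZ' : IsSmoothProjective dZ Z) (hY : IsSmoothProjective dY Y) (f : Z ⟶ Y) [Surjective f.left]
    (hpow : ∀ (e p' : ℕ) (y : complexBetti (Z.pow e) (2 * p')),
      IsAbsoluteHodgeClass (e * dZ) (Z.pow e) p' y → y ∈ algebraicClasses (Z.pow e) p')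
    (p : ℕ) (c : complexBetti Y (2 * p)) (hc : IsAbsoluteHodgeClass dY Y p c) : c ∈ algebraicClasses Y p :=
  absoluteHodge_algebraic_of_isDominatedByPowers hN hex hZ hL hcup hgys hY hZ'
    (isDominatedByPowers_of_surjective hZ' hZ' hY f (isDominatedByPowers_self hZ')) hpow p c hc

/-- **Abelian varieties: 11.2.18 passes from all powers `B^{k+1}` of `B` to every HOMOMORPHIC IMAGE `A` of `B`**
(`φ : B.X ⟶ A.X` surjective, ANY dimensions — gen 74 had subquotients of `A` from 11.2.18 at `A`; here the direction is
from the source and the relative dimension is free), mod the six facts. The hypothesis on the powers of `B` is NOT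
asserted. [cite: Arapura2006, §1 Cor. 1.2 and §4 Lemma 4.2] [cite: MumfordAV1970, §19] -/
theorem absoluteHodgeClassesAreAlgebraicFor_abelian_of_surjective_of_powers (hN : chartConjugation_canonical)
    (hex : ∀ ⦃n : ℕ⦄ ⦃X : SchemeOver ℂ⦄, IsSmoothProjective n X →
      ∀ (σ : ℂ ≃+* ℂ) (p : ℕ) (c : complexBetti X (2 * p)), ∃ s, IsConjugateClass σ X (2 * p) c s)
    (hZ : deligne1982_cycleClass_absoluteHodge) (hL : deligne1982_lefschetz_absoluteHodge_iff)
    (hcup : deligne1982_cupProduct_absoluteHodge) (hgys : deligne1982_gysinFst_absoluteHodge)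
    (B A : AbelianVariety ℂ) (φ : B.X ⟶ A.X) [Surjective φ.left]
    (hB : ∀ (e p' : ℕ) (y : complexBetti (B.X.pow e) (2 * p')),
      IsAbsoluteHodgeClass (e * B.dim) (B.X.pow e) p' y → y ∈ algebraicClasses (B.X.pow e) p') :
    AbsoluteHodgeClassesAreAlgebraicFor A.dim A.X :=
  ⟨nonempty_hodgeModel_holds AbelianVariety.isSmoothProjective_holds, fun p c hc ↦
    absoluteHodge_algebraic_of_surjective_of_powers hN hex hZ hL hcup hgys AbelianVariety.isSmoothProjective_holds
      AbelianVariety.isSmoothProjective_holds φ hB p c hc⟩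

end Surjections

/-! ## §4 Row b06 is «absolute Hodge ⟹ algebraic» on the cartesian powers of smooth projective curves (mod the six facts) -/

section Curves

variable {C : SchemeOver ℂ}

/-- **Per curve: the powers of the Jacobian decide the powers of the curve** (mod the six facts). If on every cartesian
power of the Albanese variety `J` of `𝒥 : Jacobian C` (`C` a smooth projective complex curve) every absolute Hodge class is
algebraic, then so on every `Cᵏ`: `Cᵏ` is dominated by the powers of `J` (`CorCM.Stage4.isDominatedByPowers_curve_jacobian`,
`isDominatedByPowers_pow_succ`; Arapura Lemma 1.3, second half); `C⁰ = Spec ℂ` is `algebraic_pow_zero`. The hypothesis on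
`J` is NOT asserted. [cite: Arapura2006, §1 Lemma 1.3 and §4 Lemma 4.2] -/
theorem absoluteHodge_algebraic_curvePow_of_jacobianPow (hN : chartConjugation_canonical)
    (hex : ∀ ⦃n : ℕ⦄ ⦃X : SchemeOver ℂ⦄, IsSmoothProjective n X →
      ∀ (σ : ℂ ≃+* ℂ) (p : ℕ) (c : complexBetti X (2 * p)), ∃ s, IsConjugateClass σ X (2 * p) c s)
    (hZ : deligne1982_cycleClass_absoluteHodge) (hL : deligne1982_lefschetz_absoluteHodge_iff)
    (hcup : deligne1982_cupProduct_absoluteHodge) (hgys : deligne1982_gysinFst_absoluteHodge)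
    (hC : IsSmoothProjective 1 C) (𝒥 : Jacobian C)
    (hJ : ∀ (e p : ℕ) (y : complexBetti (𝒥.J.X.pow e) (2 * p)),
      IsAbsoluteHodgeClass (e * 𝒥.J.dim) (𝒥.J.X.pow e) p y → y ∈ algebraicClasses (𝒥.J.X.pow e) p)
    (k p : ℕ) (y : complexBetti (C.pow k) (2 * p)) (hy : IsAbsoluteHodgeClass k (C.pow k) p y) :
    y ∈ algebraicClasses (C.pow k) p := by
  cases k with
  | zero => exact algebraic_pow_zero hC p y
  | succ k =>
    have hdom := isDominatedByPowers_pow_succ (AbelianVariety.isSmoothProjective_holds (A := 𝒥.J)) hC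
      (isDominatedByPowers_curve_jacobian hC 𝒥) k
    have hCk : IsSmoothProjective ((k + 1) * 1) (C.pow (k + 1)) := hC.pow (k + 1)
    exact absoluteHodge_algebraic_of_isDominatedByPowers hN hex hZ hL hcup hgys hCk
      AbelianVariety.isSmoothProjective_holds hdom hJ p y (by simpa only [Nat.mul_one] using hy)

/-- **Row b06 gives «absolute Hodge ⟹ algebraic» on every cartesian power `Cᵏ` of every smooth projective complex curve**
(through the powers of a Jacobian of `C`, which exists: `nonempty_jacobian_of_isSmoothProjective_complex`; §1), mod the six
facts. Row b06 is the displayed hypothesis `h`, NOT asserted. [cite: Arapura2006, §1 Lemma 1.3 and §4 Lemma 4.2]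
[cite: Milne1986JacobianVarieties, §1 Thm. 1.1] -/
theorem absoluteHodge_algebraic_curvePow_of_absoluteHodgeImpliesAlgebraicAV (hN : chartConjugation_canonical)
    (hex : ∀ ⦃n : ℕ⦄ ⦃X : SchemeOver ℂ⦄, IsSmoothProjective n X →
      ∀ (σ : ℂ ≃+* ℂ) (p : ℕ) (c : complexBetti X (2 * p)), ∃ s, IsConjugateClass σ X (2 * p) c s)
    (hZ : deligne1982_cycleClass_absoluteHodge) (hL : deligne1982_lefschetz_absoluteHodge_iff)
    (hcup : deligne1982_cupProduct_absoluteHodge) (hgys : deligne1982_gysinFst_absoluteHodge)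
    (h : AbsoluteHodgeImpliesAlgebraicAV) (hC : IsSmoothProjective 1 C) (k p : ℕ) (y : complexBetti (C.pow k) (2 * p))
    (hy : IsAbsoluteHodgeClass k (C.pow k) p y) : y ∈ algebraicClasses (C.pow k) p := by
  obtain ⟨𝒥⟩ := nonempty_jacobian_of_isSmoothProjective_complex C hC
  exact absoluteHodge_algebraic_curvePow_of_jacobianPow hN hex hZ hL hcup hgys hC 𝒥
    (absoluteHodge_algebraic_pow_of_absoluteHodgeImpliesAlgebraicAV hN hex h 𝒥.J) k p y hy

/-- **ROW b06 ⟺ ON EVERY CARTESIAN POWER `Cᵏ` OF EVERY SMOOTH PROJECTIVE COMPLEX CURVE `C` EVERY ABSOLUTE HODGE CLASS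
IS ALGEBRAIC** — modulo the six class-level facts of Deligne's §2, and WITHOUT Deligne's Main Theorem 2.11 (c1; compare
gen 75's `absoluteHodgeImpliesAlgebraicAV_iff_curvePow_of_deligne`). `⟹`: the previous theorem; `⟸`: every complex abelian
variety is dominated by the powers of a smooth projective curve (Arapura Lemma 1.3 + Lange–Birkenhake Prop. 4.5.8, the
tree's THEOREM `exists_curve_isDominatedByPowers_abelianVariety`) and «AH ⟹ algebraic» descends along domination
(companion, Deligne–Milne II 6.5). Neither side is asserted. [cite: Arapura2006, §1 Lemma 1.3 and §4 Lemma 4.2]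
[cite: LangeBirkenhake1992, Prop. 4.5.8] [cite: DeligneMilne1982Tannakian, II Prop. 6.5] [cite: CharlesSchnell2014Notes, §11.2.5 statement 11.2.18] -/
theorem absoluteHodgeImpliesAlgebraicAV_iff_curvePow_of_facts (hN : chartConjugation_canonical)
    (hex : ∀ ⦃n : ℕ⦄ ⦃X : SchemeOver ℂ⦄, IsSmoothProjective n X →
      ∀ (σ : ℂ ≃+* ℂ) (p : ℕ) (c : complexBetti X (2 * p)), ∃ s, IsConjugateClass σ X (2 * p) c s)
    (hZ : deligne1982_cycleClass_absoluteHodge) (hL : deligne1982_lefschetz_absoluteHodge_iff)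
    (hcup : deligne1982_cupProduct_absoluteHodge) (hgys : deligne1982_gysinFst_absoluteHodge) :
    AbsoluteHodgeImpliesAlgebraicAV ↔
      ∀ (C : SchemeOver ℂ), IsSmoothProjective 1 C → ∀ (k p : ℕ) (y : complexBetti (C.pow k) (2 * p)),
        IsAbsoluteHodgeClass k (C.pow k) p y → y ∈ algebraicClasses (C.pow k) p := by
  refine ⟨fun h C hC k p y hy ↦
    absoluteHodge_algebraic_curvePow_of_absoluteHodgeImpliesAlgebraicAV hN hex hZ hL hcup hgys h hC k p y hy,
    fun h A p c hc ↦ ?_⟩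
  obtain ⟨C, hC, hdom⟩ := exists_curve_isDominatedByPowers_abelianVariety A
  exact absoluteHodge_algebraic_of_isDominatedByPowers hN hex hZ hL hcup hgys AbelianVariety.isSmoothProjective_holds hC
    hdom (fun e p' y hy ↦ h C hC e p' y (by simpa only [Nat.mul_one] using hy)) p c hc

/-- **A counterexample to row b06, if any, can be moved to a cartesian power of a smooth projective curve by
absolute-Hodge means alone** (the `¬`-form, mod the six facts). Nothing is asserted about row b06.
[cite: Arapura2006, §1 Lemma 1.3 and §4 Lemma 4.2] [cite: LangeBirkenhake1992, Prop. 4.5.8] -/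
theorem not_absoluteHodgeImpliesAlgebraicAV_iff_exists_curvePow_of_facts (hN : chartConjugation_canonical)
    (hex : ∀ ⦃n : ℕ⦄ ⦃X : SchemeOver ℂ⦄, IsSmoothProjective n X →
      ∀ (σ : ℂ ≃+* ℂ) (p : ℕ) (c : complexBetti X (2 * p)), ∃ s, IsConjugateClass σ X (2 * p) c s)
    (hZ : deligne1982_cycleClass_absoluteHodge) (hL : deligne1982_lefschetz_absoluteHodge_iff)
    (hcup : deligne1982_cupProduct_absoluteHodge) (hgys : deligne1982_gysinFst_absoluteHodge) :
    ¬ AbsoluteHodgeImpliesAlgebraicAV ↔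
      ∃ C : SchemeOver ℂ, IsSmoothProjective 1 C ∧ ∃ (k p : ℕ) (y : complexBetti (C.pow k) (2 * p)),
        IsAbsoluteHodgeClass k (C.pow k) p y ∧ y ∉ algebraicClasses (C.pow k) p := by
  rw [absoluteHodgeImpliesAlgebraicAV_iff_curvePow_of_facts hN hex hZ hL hcup hgys]
  push Not
  rfl

/-- **PER ABELIAN VARIETY, ONE CURVE DECIDES** (mod the six facts): for every complex abelian variety `A` there is a smooth
projective curve `C` (a Lefschetz curve section; `A` is a quotient of `J(C)`) such that «AH ⟹ algebraic» on all powers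
`Cᵏ` gives Charles–Schnell's 11.2.18 at `A` and at all positive powers `A.X^{k+1}`. The hypothesis on the `Cᵏ` is NOT
asserted. [cite: Arapura2006, §1 Lemma 1.3 and §4 Lemma 4.2] [cite: LangeBirkenhake1992, Prop. 4.5.8]
[cite: Milne1986JacobianVarieties, §10 Thm. 10.1] -/
theorem exists_curve_absoluteHodgeClassesAreAlgebraicFor_of_curvePow (hN : chartConjugation_canonical)
    (hex : ∀ ⦃n : ℕ⦄ ⦃X : SchemeOver ℂ⦄, IsSmoothProjective n X →
      ∀ (σ : ℂ ≃+* ℂ) (p : ℕ) (c : complexBetti X (2 * p)), ∃ s, IsConjugateClass σ X (2 * p) c s)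
    (hZ : deligne1982_cycleClass_absoluteHodge) (hL : deligne1982_lefschetz_absoluteHodge_iff)
    (hcup : deligne1982_cupProduct_absoluteHodge) (hgys : deligne1982_gysinFst_absoluteHodge) (A : AbelianVariety ℂ) :
    ∃ C : SchemeOver ℂ, IsSmoothProjective 1 C ∧
      ((∀ (k p : ℕ) (y : complexBetti (C.pow k) (2 * p)),
          IsAbsoluteHodgeClass k (C.pow k) p y → y ∈ algebraicClasses (C.pow k) p) →
        AbsoluteHodgeClassesAreAlgebraicFor A.dim A.X ∧
          ∀ k : ℕ, AbsoluteHodgeClassesAreAlgebraicFor ((k + 1) * A.dim) (A.X.pow (k + 1))) := by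
  obtain ⟨C, hC, hdom⟩ := exists_curve_isDominatedByPowers_abelianVariety A
  have hA : IsSmoothProjective A.dim A.X := AbelianVariety.isSmoothProjective_holds
  refine ⟨C, hC, fun h ↦ ⟨⟨nonempty_hodgeModel_holds hA, fun p c hc ↦ ?_⟩, fun k ↦
    ⟨nonempty_hodgeModel_holds (hA.pow (k + 1)), fun p c hc ↦ ?_⟩⟩⟩
  · exact absoluteHodge_algebraic_of_isDominatedByPowers hN hex hZ hL hcup hgys hA hC hdom
      (fun e p' y hy ↦ h e p' y (by simpa only [Nat.mul_one] using hy)) p c hc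
  · exact absoluteHodge_algebraic_of_isDominatedByPowers hN hex hZ hL hcup hgys (hA.pow (k + 1)) hC
      (isDominatedByPowers_pow_succ hC hA hdom k) (fun e p' y hy ↦ h e p' y (by simpa only [Nat.mul_one] using hy)) p c hc

/-- **The row in Charles–Schnell's per-variety words: ROW b06 ⟺ `AbsoluteHodgeClassesAreAlgebraicFor k (Cᵏ)` for every
smooth projective complex curve `C` and every `k`** (mod the six facts; the Hodge-model conjunct of `Cᵏ` is the tree's
`nonempty_hodgeModel_holds`). Neither side is asserted. [cite: CharlesSchnell2014Notes, §11.2.5 statement 11.2.18]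
[cite: Arapura2006, §1 Lemma 1.3 and §4 Lemma 4.2] -/
theorem absoluteHodgeImpliesAlgebraicAV_iff_forall_curvePow_absoluteHodgeClassesAreAlgebraicFor
    (hN : chartConjugation_canonical)
    (hex : ∀ ⦃n : ℕ⦄ ⦃X : SchemeOver ℂ⦄, IsSmoothProjective n X →
      ∀ (σ : ℂ ≃+* ℂ) (p : ℕ) (c : complexBetti X (2 * p)), ∃ s, IsConjugateClass σ X (2 * p) c s)
    (hZ : deligne1982_cycleClass_absoluteHodge) (hL : deligne1982_lefschetz_absoluteHodge_iff)
    (hcup : deligne1982_cupProduct_absoluteHodge) (hgys : deligne1982_gysinFst_absoluteHodge) :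
    AbsoluteHodgeImpliesAlgebraicAV ↔
      ∀ (C : SchemeOver ℂ), IsSmoothProjective 1 C → ∀ k : ℕ, AbsoluteHodgeClassesAreAlgebraicFor k (C.pow k) := by
  rw [absoluteHodgeImpliesAlgebraicAV_iff_curvePow_of_facts hN hex hZ hL hcup hgys]
  refine ⟨fun h C hC k ↦ ⟨?_, fun p y hy ↦ h C hC k p y hy⟩, fun h C hC k p y hy ↦ (h C hC k).2 p y hy⟩
  simpa only [Nat.mul_one] using nonempty_hodgeModel_holds (hC.pow k)

/-- **JACOBIAN-FREE FORM THROUGH CURVE SECTIONS: ROW b06 ⟺ for every complex abelian variety `A` and every smooth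
projective curve `C → A` INJECTIVE ON `H¹` (e.g. a Lefschetz linear curve section), «AH ⟹ algebraic» holds on all powers
`Cᵏ`** (mod the six facts): such a curve DOMINATES `A` (gen 75's `isDominatedByPowers_of_injective_complexBetti_map_one`,
Serre's generation) and exists (`exists_curve_isDominatedByPowers_abelianVariety'`). The absolute twin of gen 75's
`hc_av_iff_curveSections`. Neither side is asserted. [cite: Arapura2006, §1 Lemma 1.3 and §4 Lemma 4.2]
[cite: LangeBirkenhake1992, Prop. 4.5.8] [cite: DeligneMilne1982Tannakian, II Prop. 6.5] -/
theorem absoluteHodgeImpliesAlgebraicAV_iff_curveSections_of_facts (hN : chartConjugation_canonical)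
    (hex : ∀ ⦃n : ℕ⦄ ⦃X : SchemeOver ℂ⦄, IsSmoothProjective n X →
      ∀ (σ : ℂ ≃+* ℂ) (p : ℕ) (c : complexBetti X (2 * p)), ∃ s, IsConjugateClass σ X (2 * p) c s)
    (hZ : deligne1982_cycleClass_absoluteHodge) (hL : deligne1982_lefschetz_absoluteHodge_iff)
    (hcup : deligne1982_cupProduct_absoluteHodge) (hgys : deligne1982_gysinFst_absoluteHodge) :
    AbsoluteHodgeImpliesAlgebraicAV ↔
      ∀ (A : AbelianVariety ℂ) (C : SchemeOver ℂ), IsSmoothProjective 1 C → ∀ f : C ⟶ A.X,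
        Function.Injective (complexBetti.map f 1) → ∀ (k p : ℕ) (y : complexBetti (C.pow k) (2 * p)),
          IsAbsoluteHodgeClass k (C.pow k) p y → y ∈ algebraicClasses (C.pow k) p := by
  refine ⟨fun h A C hC _ _ k p y hy ↦
    absoluteHodge_algebraic_curvePow_of_absoluteHodgeImpliesAlgebraicAV hN hex hZ hL hcup hgys h hC k p y hy,
    fun h A p c hc ↦ ?_⟩
  obtain ⟨C, hC, f, hf, hdom⟩ := exists_curve_isDominatedByPowers_abelianVariety' A
  exact absoluteHodge_algebraic_of_isDominatedByPowers hN hex hZ hL hcup hgys AbelianVariety.isSmoothProjective_holds hC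
    hdom (fun e p' y hy ↦ h A C hC f hf e p' y (by simpa only [Nat.mul_one] using hy)) p c hc

end Curves

/-! ## Audit: nothing is decided here

Every theorem above is an implication out of the OPEN row b06 (displayed hypothesis `h`) or an equivalence between row
b06 and another OPEN statement, each modulo the six named facts of record displayed as hypotheses; row b06 is never
proved, `HC_CM` / `HC_AV` / c1 do not occur. -/

end Summit.HodgeConjecture.HodgeConjecture.Ring2.Hypotheses

end
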